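import Mathlib
import HarnessLib
import Summits.NavierStokesRegularity.NavierStokesRegularity.Theorems.PoloidalWindowDoorLrcModEntireTwistingTHJacobianRates
import Summits.NavierStokesRegularity.NavierStokesRegularity.Theorems.PoloidalWindowDoorLrcModEntireTwistingTHBranchObject

/-!
# Item `LrcModEntire` (stmt-NavierStokesRegularity-20428), skeleton twist_split v6, CLASS road to `stub_twistingTHGerm` —
# (BRANCH) road: the SLOPE DICTIONARY (SD) from UNIFORM NON-FLATNESS

Cell ns-regularity-ideate, seat ns-k2-port-2 g4 (kernel-port lineage; `--supports stmt-NavierStokesRegularity-20428 --as helper`; sequel of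
`…TwistingTHJacobianRates`).  LEAD ns-poloidal-K2-p3 g13, memo OSC-LIOUVILLE-g13 v1.5 §5septies: «since μ, μ_z, μ_zz, μ_t are plane constants equal to
ratios of Jacobian entries at ANY point of the plane, they are polynomially bounded wherever one point of the plane has |∇ₕv₂| ≳ g₀/(−t)».  This file
proves exactly that, for a global (TH) slope `μ` (`∂₂v_b = μ(s,y₂)·∂_b v₂`, `uncurry μ ∈ C³` on the open slab) of a class profile:

* `slope_identities_at` — at a point `y` of the plane `{y₂ = z}` of the slice `t` with `b ≠ 2`: differentiating the identity
  `(∂₂v_b)(t, y+σe₂) = μ(t, z+σ)·(∂_b v₂)(t, y+σe₂)` in `σ` (once, twice) and `(∂₂v_b)(s,y) = μ(s,z)(∂_b v₂)(s,y)` in `s` gives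
  `μ_z·G₀ = F₁ − μ·G₁`, `μ_zz·G₀ = F₂ − 2μ_z·G₁ − μ·G₂`, `μ_t·G₀ = F_T − μ·G_T` (`F, G` the two entries, indices = line / time derivatives);
* `slopeRates_of_nonflat` — **UNIFORM NON-FLATNESS** `∀ t<0, ∀ z, ∃ y (y₂ = z), ∃ b ≠ 2, g₀·(1 + z²/(−t))^{−k} ≤ (−t)|∂_b v₂(t,y)|` (`g₀ > 0`)
  **⇒ (SD) with exponent `3k`**: `∃ K_μ ≥ 0`, `|μ|, (−t)|∂ₜμ|, √(−t)|∂_zμ|, (−t)|∂_zzμ| ≤ K_μ(1 + z²/(−t))^{3k}` (class rates of `…JacobianRates`).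

WHAT THIS IS NOT: not a claim about Navier–Stokes regularity and not the stub — calculus/bookkeeping for the (BRANCH) road (bears_on LADDER-NS N0,
item 20428 / crux 19708; both OPEN).
-/

noncomputable section

-- the summit and its single sub-problem share the name (CONVENTIONS §1), as in every Theorems file
set_option linter.dupNamespace false

namespace Summit.NavierStokesRegularity.NavierStokesRegularity.Theorems.PoloidalWindowDoorLrcModEntireTwistingTHSlopeRates

open Set Function Filter Topology
open scoped RealInnerProductSpace InnerProductSpace
open Literature.Analysis Literature.Analysis.FluidPDE
open Summit.NavierStokesRegularity.NavierStokesRegularity.Theorems.PoloidalWindowDoorLrcModEntireTwistingTHPlaneOscillationEnvelope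
  (differentiable_deriv_of_contDiff_two)
open Summit.NavierStokesRegularity.NavierStokesRegularity.Theorems.PoloidalWindowDoorLrcModEntireTwistingTHBranchLaw
open Summit.NavierStokesRegularity.NavierStokesRegularity.Theorems.PoloidalWindowDoorLrcModEntireTwistingTHBranchObject (deriv_mul_two)
open Summit.NavierStokesRegularity.NavierStokesRegularity.Theorems.PoloidalWindowDoorLrcModEntireTwistingTHJacobianRates

/-! ### Algebra helpers -/

/-- From `x·D ≤ B`, `0 ≤ x`, `0 < d ≤ D`: `x ≤ B/d`. -/
theorem le_div_of_mul_le {x D d B : ℝ} (hx : 0 ≤ x) (h : x * D ≤ B) (hd : 0 < d) (hdD : d ≤ D) : x ≤ B / d := by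
  rw [le_div_iff₀ hd]
  exact (mul_le_mul_of_nonneg_left hdD hx).trans h

/-- Polynomial weights: `P ≥ 1 ⇒ P ≤ P³`, `P² ≤ P³`, with `P³ = (1+z²/(−t))^{3k}`. -/
theorem poly_cube_facts {t : ℝ} (ht : t < 0) (z : ℝ) (k : ℕ) :
    1 ≤ (1 + z ^ 2 / (-t)) ^ k ∧
    (1 + z ^ 2 / (-t)) ^ k ≤ (1 + z ^ 2 / (-t)) ^ (3 * k) ∧
    (1 + z ^ 2 / (-t)) ^ k * (1 + z ^ 2 / (-t)) ^ k ≤ (1 + z ^ 2 / (-t)) ^ (3 * k) ∧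
    (1 + z ^ 2 / (-t)) ^ (3 * k) = (1 + z ^ 2 / (-t)) ^ k * (1 + z ^ 2 / (-t)) ^ k * (1 + z ^ 2 / (-t)) ^ k := by
  have hnt : 0 < -t := neg_pos.2 ht
  have hP1 : (1 : ℝ) ≤ (1 + z ^ 2 / (-t)) ^ k :=
    one_le_pow₀ (le_add_of_nonneg_right (div_nonneg (sq_nonneg z) hnt.le))
  have hP3 : (1 + z ^ 2 / (-t)) ^ (3 * k) = (1 + z ^ 2 / (-t)) ^ k * (1 + z ^ 2 / (-t)) ^ k * (1 + z ^ 2 / (-t)) ^ k := by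
    rw [show 3 * k = k + k + k by ring, pow_add, pow_add]
  set P := (1 + z ^ 2 / (-t)) ^ k
  have hP0 : 0 ≤ P := zero_le_one.trans hP1
  refine ⟨hP1, ?_, ?_, hP3⟩
  · rw [hP3]; nlinarith [mul_nonneg hP0 hP0, mul_le_mul hP1 hP1 zero_le_one hP0]
  · rw [hP3]; exact le_mul_of_one_le_right (mul_nonneg hP0 hP0) hP1

/-- **The slope algebra** (opaque real variables): from the four identities of `slope_identities_at`, the non-flatness `g₀/P ≤ (−t)|G₀|` and the
entry rates, the four normalised slope quantities are polynomially bounded. -/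
theorem slope_algebra {t g₀ P KJ KT μ0 μz μzz μt G0 F0 F1 G1 F2 G2 FT GT : ℝ} (ht : 0 < -t) (hg₀ : 0 < g₀) (hKJ : 0 ≤ KJ) (hKT : 0 ≤ KT)
    (hP1 : 1 ≤ P) (hD : g₀ / P ≤ (-t) * |G0|)
    (i0 : μ0 * G0 = F0) (i1 : μz * G0 = F1 - μ0 * G1) (i2 : μzz * G0 = F2 - 2 * μz * G1 - μ0 * G2) (i3 : μt * G0 = FT - μ0 * GT)
    (rF0 : (-t) * |F0| ≤ KJ) (rF1 : (-t) * Real.sqrt (-t) * |F1| ≤ KJ) (rG1 : (-t) * Real.sqrt (-t) * |G1| ≤ KJ)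
    (rF2 : (-t) ^ 2 * |F2| ≤ KJ) (rG2 : (-t) ^ 2 * |G2| ≤ KJ) (rFT : (-t) ^ 2 * |FT| ≤ KT) (rGT : (-t) ^ 2 * |GT| ≤ KT) :
    |μ0| ≤ KJ / g₀ * P ∧
    Real.sqrt (-t) * |μz| ≤ (KJ / g₀ * (1 + KJ / g₀)) * (P * P) ∧
    (-t) * |μzz| ≤ (KJ / g₀ * (1 + 2 * (KJ / g₀ * (1 + KJ / g₀)) + KJ / g₀)) * (P * P * P) ∧
    (-t) * |μt| ≤ (KT / g₀ * (1 + KJ / g₀)) * (P * P) := by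
  have hs : 0 < Real.sqrt (-t) := Real.sqrt_pos.2 ht
  have hst : Real.sqrt (-t) * Real.sqrt (-t) = -t := Real.mul_self_sqrt ht.le
  have hP0 : 0 < P := lt_of_lt_of_le one_pos hP1
  have hd : 0 < g₀ / P := div_pos hg₀ hP0
  have hA₁0 : 0 ≤ KJ / g₀ := div_nonneg hKJ hg₀.le
  -- (a) the slope
  have ha : |μ0| ≤ KJ / g₀ * P := by
    have h1 : |μ0| * ((-t) * |G0|) ≤ KJ := by
      have e : |μ0| * ((-t) * |G0|) = (-t) * |μ0 * G0| := by rw [abs_mul]; ring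
      rw [e, i0]; exact rF0
    have h2 := le_div_of_mul_le (abs_nonneg _) h1 hd hD
    rw [div_div_eq_mul_div] at h2
    calc |μ0| ≤ KJ * P / g₀ := h2
      _ = KJ / g₀ * P := by ring
  -- (b) the height derivative
  have hb' : Real.sqrt (-t) * |μz| ≤ KJ / g₀ * (1 + |μ0|) * P := by
    have h1 : (Real.sqrt (-t) * |μz|) * ((-t) * |G0|) ≤ KJ * (1 + |μ0|) := by
      have e : (Real.sqrt (-t) * |μz|) * ((-t) * |G0|) = Real.sqrt (-t) * (-t) * |μz * G0| := by rw [abs_mul]; ring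
      rw [e, i1]
      calc Real.sqrt (-t) * (-t) * |F1 - μ0 * G1| ≤ Real.sqrt (-t) * (-t) * (|F1| + |μ0 * G1|) :=
            mul_le_mul_of_nonneg_left (abs_sub _ _) (mul_nonneg hs.le ht.le)
        _ = (-t) * Real.sqrt (-t) * |F1| + |μ0| * ((-t) * Real.sqrt (-t) * |G1|) := by rw [abs_mul]; ring
        _ ≤ KJ + |μ0| * KJ := add_le_add rF1 (mul_le_mul_of_nonneg_left rG1 (abs_nonneg _))
        _ = KJ * (1 + |μ0|) := by ring
    have h2 := le_div_of_mul_le (mul_nonneg hs.le (abs_nonneg _)) h1 hd hD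
    rw [div_div_eq_mul_div] at h2
    calc Real.sqrt (-t) * |μz| ≤ KJ * (1 + |μ0|) * P / g₀ := h2
      _ = KJ / g₀ * (1 + |μ0|) * P := by ring
  have hb2 : Real.sqrt (-t) * |μz| ≤ (KJ / g₀ * (1 + KJ / g₀)) * (P * P) := by
    have h3 : KJ / g₀ * (1 + |μ0|) * P ≤ KJ / g₀ * (1 + KJ / g₀ * P) * P :=
      mul_le_mul_of_nonneg_right (mul_le_mul_of_nonneg_left (by linarith) hA₁0) hP0.le
    have h4 : KJ / g₀ * (1 + KJ / g₀ * P) * P ≤ (KJ / g₀ * (1 + KJ / g₀)) * (P * P) := by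
      have e : (KJ / g₀ * (1 + KJ / g₀)) * (P * P) - KJ / g₀ * (1 + KJ / g₀ * P) * P = KJ / g₀ * P * (P - 1) := by ring
      rw [← sub_nonneg, e]; exact mul_nonneg (mul_nonneg hA₁0 hP0.le) (sub_nonneg.2 hP1)
    exact hb'.trans (h3.trans h4)
  -- (c) the second height derivative
  have hc : (-t) * |μzz| ≤ (KJ / g₀ * (1 + 2 * (KJ / g₀ * (1 + KJ / g₀)) + KJ / g₀)) * (P * P * P) := by
    have h1 : ((-t) * |μzz|) * ((-t) * |G0|) ≤ KJ * (1 + 2 * (Real.sqrt (-t) * |μz|) + |μ0|) := by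
      have e : ((-t) * |μzz|) * ((-t) * |G0|) = (-t) ^ 2 * |μzz * G0| := by rw [abs_mul]; ring
      rw [e, i2]
      have eG1 : (-t) ^ 2 * |G1| = Real.sqrt (-t) * ((-t) * Real.sqrt (-t) * |G1|) := by
        rw [show Real.sqrt (-t) * ((-t) * Real.sqrt (-t) * |G1|) = (-t) * (Real.sqrt (-t) * Real.sqrt (-t)) * |G1| by ring, hst]; ring
      calc (-t) ^ 2 * |F2 - 2 * μz * G1 - μ0 * G2| ≤ (-t) ^ 2 * (|F2| + |2 * μz * G1| + |μ0 * G2|) :=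
            mul_le_mul_of_nonneg_left ((abs_sub _ _).trans (add_le_add (abs_sub _ _) le_rfl)) (pow_nonneg ht.le 2)
        _ = (-t) ^ 2 * |F2| + 2 * |μz| * ((-t) ^ 2 * |G1|) + |μ0| * ((-t) ^ 2 * |G2|) := by
            rw [abs_mul, abs_mul, abs_mul, abs_two]; ring
        _ ≤ KJ + 2 * |μz| * (Real.sqrt (-t) * KJ) + |μ0| * KJ := by
            rw [eG1]
            exact add_le_add (add_le_add rF2 (mul_le_mul_of_nonneg_left (mul_le_mul_of_nonneg_left rG1 hs.le)
              (mul_nonneg zero_le_two (abs_nonneg _)))) (mul_le_mul_of_nonneg_left rG2 (abs_nonneg _))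
        _ = KJ * (1 + 2 * (Real.sqrt (-t) * |μz|) + |μ0|) := by ring
    have h2 := le_div_of_mul_le (mul_nonneg ht.le (abs_nonneg _)) h1 hd hD
    rw [div_div_eq_mul_div] at h2
    have h3 : KJ * (1 + 2 * (Real.sqrt (-t) * |μz|) + |μ0|) * P / g₀ ≤
        KJ / g₀ * (1 + 2 * ((KJ / g₀ * (1 + KJ / g₀)) * (P * P)) + KJ / g₀ * P) * P := by
      rw [show KJ * (1 + 2 * (Real.sqrt (-t) * |μz|) + |μ0|) * P / g₀ = KJ / g₀ * (1 + 2 * (Real.sqrt (-t) * |μz|) + |μ0|) * P by ring]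
      exact mul_le_mul_of_nonneg_right (mul_le_mul_of_nonneg_left (by linarith) hA₁0) hP0.le
    have h4 : KJ / g₀ * (1 + 2 * ((KJ / g₀ * (1 + KJ / g₀)) * (P * P)) + KJ / g₀ * P) * P ≤
        (KJ / g₀ * (1 + 2 * (KJ / g₀ * (1 + KJ / g₀)) + KJ / g₀)) * (P * P * P) := by
      have e : (KJ / g₀ * (1 + 2 * (KJ / g₀ * (1 + KJ / g₀)) + KJ / g₀)) * (P * P * P)
          - KJ / g₀ * (1 + 2 * ((KJ / g₀ * (1 + KJ / g₀)) * (P * P)) + KJ / g₀ * P) * P =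
          KJ / g₀ * P * ((P * P - 1) + KJ / g₀ * (P * P - P)) := by ring
      rw [← sub_nonneg, e]
      have hPP : 0 ≤ P * P - 1 := by nlinarith
      have hPP' : 0 ≤ P * P - P := by nlinarith
      exact mul_nonneg (mul_nonneg hA₁0 hP0.le) (add_nonneg hPP (mul_nonneg hA₁0 hPP'))
    exact h2.trans (h3.trans h4)
  -- (d) the time derivative
  have hd' : (-t) * |μt| ≤ (KT / g₀ * (1 + KJ / g₀)) * (P * P) := by
    have h1 : ((-t) * |μt|) * ((-t) * |G0|) ≤ KT * (1 + |μ0|) := by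
      have e : ((-t) * |μt|) * ((-t) * |G0|) = (-t) ^ 2 * |μt * G0| := by rw [abs_mul]; ring
      rw [e, i3]
      calc (-t) ^ 2 * |FT - μ0 * GT| ≤ (-t) ^ 2 * (|FT| + |μ0 * GT|) := mul_le_mul_of_nonneg_left (abs_sub _ _) (pow_nonneg ht.le 2)
        _ = (-t) ^ 2 * |FT| + |μ0| * ((-t) ^ 2 * |GT|) := by rw [abs_mul]; ring
        _ ≤ KT + |μ0| * KT := add_le_add rFT (mul_le_mul_of_nonneg_left rGT (abs_nonneg _))
        _ = KT * (1 + |μ0|) := by ring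
    have h2 := le_div_of_mul_le (mul_nonneg ht.le (abs_nonneg _)) h1 hd hD
    rw [div_div_eq_mul_div] at h2
    have hT0 : 0 ≤ KT / g₀ := div_nonneg hKT hg₀.le
    have h3 : KT * (1 + |μ0|) * P / g₀ ≤ KT / g₀ * (1 + KJ / g₀ * P) * P := by
      rw [show KT * (1 + |μ0|) * P / g₀ = KT / g₀ * (1 + |μ0|) * P by ring]
      exact mul_le_mul_of_nonneg_right (mul_le_mul_of_nonneg_left (by linarith) hT0) hP0.le
    have h4 : KT / g₀ * (1 + KJ / g₀ * P) * P ≤ (KT / g₀ * (1 + KJ / g₀)) * (P * P) := by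
      have e : (KT / g₀ * (1 + KJ / g₀)) * (P * P) - KT / g₀ * (1 + KJ / g₀ * P) * P = KT / g₀ * P * (P - 1) := by ring
      rw [← sub_nonneg, e]; exact mul_nonneg (mul_nonneg hT0 hP0.le) (sub_nonneg.2 hP1)
    exact h2.trans (h3.trans h4)
  exact ⟨ha, hb2, hc, hd'⟩

/-! ### The class setting -/

section Class

variable {C : ℝ} {v : ℝ → EuclideanSpace ℝ (Fin 3) → EuclideanSpace ℝ (Fin 3)}
variable (hrate : HasTypeITimeDecay C v) (hcont : ContinuousOn (uncurry v) (Iio (0 : ℝ) ×ˢ univ))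
  (hmild : ∀ s t : ℝ, s < t → t < 0 → ∀ x,
    v t x = UnboundedOperators.heatExtension (v s) (t - s) x - oseenDuhamel 1 s v v t x)
  (hdiv : ∀ t < 0, VectorCalculus.IsDivFree (v t))
  {μ : ℝ → ℝ → ℝ}
  (hTH : ∀ s < 0, ∀ y : EuclideanSpace ℝ (Fin 3), ∀ b : Fin 3, b ≠ 2 →
    fderiv ℝ (v s) y (EuclideanSpace.single 2 1) b = μ s (y 2) * fderiv ℝ (v s) y (EuclideanSpace.single b 1) 2)
  (hμC : ContDiffOn ℝ 3 (uncurry μ) (Iio (0 : ℝ) ×ˢ univ))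

include hrate hcont hmild hdiv hTH hμC

/-- **THE SLOPE IDENTITIES AT ONE POINT OF A PLANE.**  At `y` on the plane `{y₂ = z}` of the slice `t < 0`, for `b ≠ 2`, with the entries
`F(s,x) = (∂₂v_b)(s,x)`, `G(s,x) = (∂_b v₂)(s,x)`, their first / second vertical line derivatives `F₁,G₁ / F₂,G₂` at `(t,y)` and their time
derivatives `F_T, G_T` (all in the spelling of `…JacobianRates`):
`μ·G = F`, `μ_z·G = F₁ − μ·G₁`, `μ_zz·G = F₂ − 2μ_z·G₁ − μ·G₂`, `μ_t·G = F_T − μ·G_T`. -/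
theorem slope_identities_at {t : ℝ} (ht : t < 0) {z : ℝ} {y : EuclideanSpace ℝ (Fin 3)} (hy : y 2 = z) {b : Fin 3} (hb : b ≠ 2) :
    μ t z * (fderiv ℝ (v t) y (EuclideanSpace.single b 1)) 2 = (fderiv ℝ (v t) y (EuclideanSpace.single 2 1)) b ∧
    deriv (μ t) z * (fderiv ℝ (v t) y (EuclideanSpace.single b 1)) 2 =
      (fderiv ℝ (fun x => fderiv ℝ (v t) x (EuclideanSpace.single 2 1)) y (EuclideanSpace.single 2 1)) b
        - μ t z * (fderiv ℝ (fun x => fderiv ℝ (v t) x (EuclideanSpace.single b 1)) y (EuclideanSpace.single 2 1)) 2 ∧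
    deriv (deriv (μ t)) z * (fderiv ℝ (v t) y (EuclideanSpace.single b 1)) 2 =
      (fderiv ℝ (fun x => fderiv ℝ (fun x => fderiv ℝ (v t) x (EuclideanSpace.single 2 1)) x (EuclideanSpace.single 2 1)) y
          (EuclideanSpace.single 2 1)) b
        - 2 * deriv (μ t) z * (fderiv ℝ (fun x => fderiv ℝ (v t) x (EuclideanSpace.single b 1)) y (EuclideanSpace.single 2 1)) 2
        - μ t z * (fderiv ℝ (fun x => fderiv ℝ (fun x => fderiv ℝ (v t) x (EuclideanSpace.single b 1)) x (EuclideanSpace.single 2 1)) y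
          (EuclideanSpace.single 2 1)) 2 ∧
    deriv (fun s => μ s z) t * (fderiv ℝ (v t) y (EuclideanSpace.single b 1)) 2 =
      (fderiv ℝ (fun x => deriv (fun τ => v τ x) t) y (EuclideanSpace.single 2 1)) b
        - μ t z * (fderiv ℝ (fun x => deriv (fun τ => v τ x) t) y (EuclideanSpace.single b 1)) 2 := by
  set e2 : EuclideanSpace ℝ (Fin 3) := EuclideanSpace.single 2 (1 : ℝ) with he2
  set eb : EuclideanSpace ℝ (Fin 3) := EuclideanSpace.single b (1 : ℝ) with heb
  -- the height of the vertical line through `y`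
  have hline : ∀ σ : ℝ, (y + σ • e2) 2 = z + σ := by intro σ; simp [he2, hy]
  -- ### the vertical-line functions
  set Fσ : ℝ → ℝ := fun σ => (fderiv ℝ (v t) (y + σ • e2) e2) b with hFσ
  set Gσ : ℝ → ℝ := fun σ => (fderiv ℝ (v t) (y + σ • e2) eb) 2 with hGσ
  set hσ : ℝ → ℝ := fun σ => μ t (z + σ) with hhσ
  have hid : Fσ = fun σ => hσ σ * Gσ σ := by
    funext σ
    simp only [hFσ, hGσ, hhσ]
    rw [← hline σ]
    exact hTH t ht (y + σ • e2) b hb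
  -- derivatives of the entries along the line
  have hF1 := fun σ => hasDerivAt_entry_line hrate hcont hmild hdiv ht y e2 e2 b σ
  have hG1 := fun σ => hasDerivAt_entry_line hrate hcont hmild hdiv ht y e2 eb 2 σ
  have hF2 := fun σ => hasDerivAt_entry_line_two hrate hcont hmild hdiv ht y e2 e2 b σ
  have hG2 := fun σ => hasDerivAt_entry_line_two hrate hcont hmild hdiv ht y e2 eb 2 σ
  -- the slope slice along the line
  have hμt3 : ContDiff ℝ 3 (μ t) := contDiff_heightSlice hμC ht
  have hμt2 : ContDiff ℝ 2 (μ t) := hμt3.of_le (by norm_cast)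
  have hμd : Differentiable ℝ (μ t) := hμt2.differentiable (by norm_num)
  have hμ'd : Differentiable ℝ (deriv (μ t)) := differentiable_deriv_of_contDiff_two hμt2
  have hh1 : ∀ σ, HasDerivAt hσ (deriv (μ t) (z + σ)) σ := fun σ => by
    simpa [hhσ] using ((hμd (z + σ)).hasDerivAt.comp_const_add z σ)
  have hhC : ContDiff ℝ 2 hσ := hμt2.comp (contDiff_const.add contDiff_id)
  have hGC : ContDiff ℝ 2 Gσ := by
    obtain ⟨hE, -⟩ := contDiff_entry hrate hcont hmild hdiv ht eb e2
    have hl : ContDiff ℝ 2 (fun σ : ℝ => y + σ • e2) := contDiff_const.add (contDiff_id.smul contDiff_const)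
    exact (EuclideanSpace.proj (𝕜 := ℝ) (2 : Fin 3)).contDiff.comp (hE.comp hl)
  -- first derivatives as functions
  have dG : deriv Gσ = fun σ => (fderiv ℝ (fun x => fderiv ℝ (v t) x eb) (y + σ • e2) e2) 2 := funext fun σ => (hG1 σ).deriv
  have dF : deriv Fσ = fun σ => (fderiv ℝ (fun x => fderiv ℝ (v t) x e2) (y + σ • e2) e2) b := funext fun σ => (hF1 σ).deriv
  have dh : deriv hσ = fun σ => deriv (μ t) (z + σ) := funext fun σ => (hh1 σ).deriv
  have ddh : deriv (deriv hσ) 0 = deriv (deriv (μ t)) z := by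
    rw [dh]
    have h := ((hμ'd (z + 0)).hasDerivAt.comp_const_add z 0).deriv
    simpa using h
  have ddG : deriv (deriv Gσ) 0 = (fderiv ℝ (fun x => fderiv ℝ (fun x => fderiv ℝ (v t) x eb) x e2) y e2) 2 := by
    rw [dG, (hG2 0).deriv]; simp
  have ddF : deriv (deriv Fσ) 0 = (fderiv ℝ (fun x => fderiv ℝ (fun x => fderiv ℝ (v t) x e2) x e2) y e2) b := by
    rw [dF, (hF2 0).deriv]; simp
  refine ⟨?_, ?_, ?_, ?_⟩
  · -- `μ·G = F`
    have h := congrFun hid 0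
    simp only [hFσ, hGσ, hhσ, zero_smul, add_zero] at h
    exact h.symm
  · -- `μ_z·G = F₁ − μ·G₁`
    have hprod : HasDerivAt Fσ (deriv (μ t) (z + 0) * Gσ 0 + hσ 0 * (fderiv ℝ (fun x => fderiv ℝ (v t) x eb) (y + (0:ℝ) • e2) e2) 2) 0 := by
      rw [hid]; exact (hh1 0).mul (hG1 0)
    have huniq := (hF1 0).unique hprod
    simp only [hGσ, hhσ, zero_smul, add_zero] at huniq
    linarith
  · -- `μ_zz·G = F₂ − 2μ_z·G₁ − μ·G₂`
    obtain ⟨-, d2⟩ := deriv_mul_two hhC hGC 0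
    rw [← hid, ddF, ddh, ddG, dh, dG] at d2
    simp only [hGσ, hhσ, zero_smul, add_zero] at d2
    linarith
  · -- `μ_t·G = F_T − μ·G_T`
    have hFt := hasDerivAt_entry_time hrate hcont hmild hdiv ht y e2 b
    have hGt := hasDerivAt_entry_time hrate hcont hmild hdiv ht y eb 2
    have hks : HasDerivAt (fun s => μ s z) (deriv (fun s => μ s z) t) t := (differentiableAt_timeSlice hμC (by simp) ht z).hasDerivAt
    have hidt : (fun s => (fderiv ℝ (v s) y e2) b) =ᶠ[𝓝 t] fun s => μ s z * (fderiv ℝ (v s) y eb) 2 := by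
      filter_upwards [Iio_mem_nhds ht] with s hs
      rw [← hy]; exact hTH s hs y b hb
    have hprod : HasDerivAt (fun s => μ s z * (fderiv ℝ (v s) y eb) 2)
        (deriv (fun s => μ s z) t * (fderiv ℝ (v t) y eb) 2 +
          μ t z * (fderiv ℝ (fun x => deriv (fun τ => v τ x) t) y eb) 2) t := hks.mul hGt
    have huniq := hFt.unique (hprod.congr_of_eventuallyEq hidt)
    linarith

/-- **UNIFORM NON-FLATNESS ⇒ THE SLOPE DICTIONARY (SD)** with exponent `3k` (module docstring). -/
theorem slopeRates_of_nonflat {g₀ : ℝ} {k : ℕ} (hg₀ : 0 < g₀)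
    (hg : ∀ t < 0, ∀ z : ℝ, ∃ y : EuclideanSpace ℝ (Fin 3), ∃ b : Fin 3, y 2 = z ∧ b ≠ 2 ∧
      g₀ * ((1 + z ^ 2 / (-t)) ^ k)⁻¹ ≤ (-t) * |(fderiv ℝ (v t) y (EuclideanSpace.single b 1)) 2|) :
    ∃ Kμ : ℝ, 0 ≤ Kμ ∧
      (∀ t < 0, ∀ z, |μ t z| ≤ Kμ * (1 + z ^ 2 / (-t)) ^ (3 * k)) ∧
      (∀ t < 0, ∀ z, (-t) * |deriv (fun s => μ s z) t| ≤ Kμ * (1 + z ^ 2 / (-t)) ^ (3 * k)) ∧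
      (∀ t < 0, ∀ z, Real.sqrt (-t) * |deriv (μ t) z| ≤ Kμ * (1 + z ^ 2 / (-t)) ^ (3 * k)) ∧
      (∀ t < 0, ∀ z, (-t) * |deriv (deriv (μ t)) z| ≤ Kμ * (1 + z ^ 2 / (-t)) ^ (3 * k)) := by
  obtain ⟨KJ, hKJ0, hJ⟩ := entry_line_rates hrate hcont hmild hdiv
  obtain ⟨KT, hKT0, hT⟩ := entry_time_rate hrate hcont hmild
  have hA₁0 : 0 ≤ KJ / g₀ := div_nonneg hKJ0 hg₀.le
  have hA₂0 : 0 ≤ KJ / g₀ * (1 + KJ / g₀) := by positivity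
  have hA₃0 : 0 ≤ KJ / g₀ * (1 + 2 * (KJ / g₀ * (1 + KJ / g₀)) + KJ / g₀) := by positivity
  have hA₄0 : 0 ≤ KT / g₀ * (1 + KJ / g₀) := by positivity
  refine ⟨KJ / g₀ + KJ / g₀ * (1 + KJ / g₀) + KJ / g₀ * (1 + 2 * (KJ / g₀ * (1 + KJ / g₀)) + KJ / g₀) + KT / g₀ * (1 + KJ / g₀),
    by positivity, ?_, ?_, ?_, ?_⟩
  all_goals intro t ht z
  all_goals have hnt : 0 < -t := neg_pos.2 ht
  all_goals obtain ⟨hP1, hP13, hP23, hP3⟩ := poly_cube_facts ht z k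
  all_goals have hP30 : (0 : ℝ) ≤ (1 + z ^ 2 / (-t)) ^ (3 * k) := le_trans (zero_le_one.trans hP1) hP13
  all_goals obtain ⟨y, b, hy, hb, hG⟩ := hg t ht z
  all_goals rw [← one_div, mul_one_div] at hG
  all_goals obtain ⟨i0, i1, i2, i3⟩ := slope_identities_at hrate hcont hmild hdiv hTH hμC ht hy hb
  all_goals have hn2 : ‖(EuclideanSpace.single 2 (1 : ℝ) : EuclideanSpace ℝ (Fin 3))‖ ≤ 1 := by simp
  all_goals have hnb : ‖(EuclideanSpace.single b (1 : ℝ) : EuclideanSpace ℝ (Fin 3))‖ ≤ 1 := by simp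
  all_goals obtain ⟨rF0, rF1, rF2⟩ := hJ t ht y _ _ hn2 hn2 b
  all_goals obtain ⟨-, rG1, rG2⟩ := hJ t ht y _ _ hn2 hnb 2
  all_goals have rFT := hT t ht y _ hn2 b
  all_goals have rGT := hT t ht y _ hnb 2
  all_goals obtain ⟨ka, kb, kc, kd⟩ := slope_algebra hnt hg₀ hKJ0 hKT0 hP1 hG i0 i1 i2 i3 rF0 rF1 rG1 rF2 rG2 rFT rGT
  · exact ka.trans ((mul_le_mul_of_nonneg_left hP13 hA₁0).trans (mul_le_mul_of_nonneg_right (by linarith) hP30))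
  · exact kd.trans ((mul_le_mul_of_nonneg_left hP23 hA₄0).trans (mul_le_mul_of_nonneg_right (by linarith) hP30))
  · exact kb.trans ((mul_le_mul_of_nonneg_left hP23 hA₂0).trans (mul_le_mul_of_nonneg_right (by linarith) hP30))
  · rw [hP3]; exact kc.trans (mul_le_mul_of_nonneg_right (by linarith) (hP3 ▸ hP30))

end Class

end Summit.NavierStokesRegularity.NavierStokesRegularity.Theorems.PoloidalWindowDoorLrcModEntireTwistingTHSlopeRates
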